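import Mathlib
import Literature.Computability.Complexity.RangeAvoidance
import Literature.Computability.Complexity.SignDegreeXor
import Summits.PneNP.PneNP.Theorems.PstarPDT
import Summits.PneNP.PneNP.Theorems.PstarPDTFromSA
import Summits.PneNP.PneNP.Theorems.PstarFibrePolys
import Summits.PneNP.PneNP.Theorems.PstarSALevel
import Summits.PneNP.PneNP.Theorems.PstarSAClosure
import Summits.PneNP.PneNP.Theorems.PstarTyped
import Summits.PneNP.PneNP.Theorems.PstarGapPeeling
import Summits.PneNP.PneNP.Theorems.PstarCentreFree
import Summits.PneNP.PneNP.Theorems.PstarGraphQuadGapOne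

/-!
# One AND-parity: chord repairs with parity freedom (ROUND-24 item T24.16, part I)

FRONTIER range-avoidance ladder, rung F-N3, ROUND 24 (cell `pnp-ideate`; restricted-model proof complexity — nothing here bears on
`P` versus `NP`).  Infrastructure for `PstarNoDeadCentre.GapOneAnd` (sequel `PstarGapOneAnd`); paper proof: planner memo §13 R10(j),
referee audit AUDIT-r10j-noDeadCentre-g43.

Setting: a pure typed `P⋆` instance, a target `y`, an output set `J`, ONE parity constraint `⊕_{v ∈ C} z_v = c` whose variables
occur in no XOR slot.  A CHORD of `J` is an output whose two AND variables are `J`-private (`∈ bdry I J`).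

* `bit_parity_update`: the parity of `C` after updating one variable.
* `eval_update_and_slot`: toggling one AND slot whose partner is `true` toggles the output.
* **`repair`**: if `z₁` solves every output of `J` outside a non-empty set `R` of chords carrying a `C`-variable, and the XOR part alone
  of every chord of `R` already gives its target (i.e. it needs product `0`), then `J` is solvable WITH THE PRESCRIBED PARITY: zero all
  AND pairs of `R` (private, AND-type — nothing else moves), then, if the parity is wrong, raise one `C`-variable of one chord (pattern
  `(1,0)` still has product `0`).
* `chord_true` (S3 of the paper proof): if `J` is infeasible under the constraint, every solution of `J` has every `C`-carrying chord at
  `(1,1)` — otherwise `repair` with `R = {g}` applies.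
* Endgames contradicting infeasibility: `endgame_all` (E1: an XOR variable all of whose readers are such chords — flip it),
  `endgame_leaf` (E2: an XOR variable of an output `f` with a private AND leaf and active partner, all other readers chords — flip
  it and the leaf), `endgame_double` (E3: both XOR variables of `f` read otherwise only by chords, none reading both — flip both).
-/

set_option linter.dupNamespace false -- `Summit.PneNP.PneNP.…`: summit = sub-problem name (D-0017 single-conjunct layout)

open Finset Literature.Computability.Complexity
open Summit.PneNP.PneNP.Theorems.PstarPDT (parity)
open Summit.PneNP.PneNP.Theorems.PstarPDTFromSA (parity_congr)
open Summit.PneNP.PneNP.Theorems.PstarFibrePolys (bit bit_injective)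
open Summit.PneNP.PneNP.Theorems.PstarTyped (Typed)
open Summit.PneNP.PneNP.Theorems.PstarSALevel (varSet bdry)
open Summit.PneNP.PneNP.Theorems.PstarGapPeeling (eval_congr not_mem_varSet_of_private eval_update_of_not_mem eval_pure
  eval_update_xor_slot)
open Summit.PneNP.PneNP.Theorems.PstarCentreFree (vars_mem_varSet)
open Summit.PneNP.PneNP.Theorems.PstarGraphQuadGapOne (bit_parity)

namespace Summit.PneNP.PneNP.Theorems.PstarGapOneAndRepair

variable {n m : ℕ}

/-! ## Small facts -/

/-- In `𝔽₂`, `x + x = 0`. -/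
private theorem zmod2_add_self (x : ZMod 2) : x + x = 0 := by
  revert x; decide

/-- `bit (¬b) = bit b + 1`. -/
theorem bit_not (b : Bool) : bit (!b) = bit b + 1 := by
  cases b <;> decide

/-- A variable read by `j` is one of its four slot variables. -/
theorem exists_slot_of_mem_varSet (I : LocalMap 4 n m) {j : Fin m} {v : Fin n} (hv : v ∈ varSet I j) :
    ∃ s : Fin 4, I.vars j s = v := by
  unfold PstarSALevel.varSet at hv
  obtain ⟨s, -, hs⟩ := mem_image.1 hv
  exact ⟨s, hs⟩

/-- On a typed instance an XOR-slot variable read by `g` is an XOR slot of `g`. -/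
theorem xor_slot_of_mem (I : LocalMap 4 n m) (hT : Typed I) {f g : Fin m} {s : Fin 4} (hs : s.val < 2)
    (hm : I.vars f s ∈ varSet I g) : I.vars g 0 = I.vars f s ∨ I.vars g 1 = I.vars f s := by
  obtain ⟨t, ht⟩ := exists_slot_of_mem_varSet I hm
  have ht2 : t.val < 2 := by
    by_contra h
    push Not at h
    exact hT f g s t hs h ht.symm
  have : t = 0 ∨ t = 1 := by fin_cases t <;> simp at ht2 ⊢
  rcases this with rfl | rfl
  · exact Or.inl ht
  · exact Or.inr ht

/-! ## Parity bookkeeping -/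

/-- **Parity after one update**: `bit (parity C z[v ↦ b]) = bit (parity C z) + [v ∈ C]·(bit b + bit (z v))`. -/
theorem bit_parity_update (C : Finset (Fin n)) (z : Fin n → Bool) (v : Fin n) (b : Bool) :
    bit (parity C (Function.update z v b)) = bit (parity C z) + if v ∈ C then bit b + bit (z v) else 0 := by
  rw [bit_parity, bit_parity]
  have key : ∀ w ∈ C, bit (Function.update z v b w) = bit (z w) + if w = v then bit b + bit (z v) else 0 := by
    intro w _
    by_cases h : w = v
    · subst h
      rw [Function.update_self, if_pos rfl]
      have := zmod2_add_self (bit (z w))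
      linear_combination -this
    · rw [Function.update_of_ne h, if_neg h, add_zero]
  rw [sum_congr rfl key, sum_add_distrib, sum_ite_eq']

/-- Updating a variable outside `C` keeps the parity. -/
theorem parity_update_of_not_mem {C : Finset (Fin n)} (z : Fin n → Bool) {v : Fin n} (hv : v ∉ C) (b : Bool) :
    parity C (Function.update z v b) = parity C z :=
  parity_congr fun i hi => by
    have hne : i ≠ v := fun h => hv (h ▸ hi)
    rw [Function.update_of_ne hne]

/-- Raising a `false` variable of `C` to `true` flips the parity. -/
theorem parity_update_flip {C : Finset (Fin n)} (z : Fin n → Bool) {v : Fin n} (hv : v ∈ C) (hz : z v = false) :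
    parity C (Function.update z v true) = !parity C z := by
  apply bit_injective
  rw [bit_parity_update, if_pos hv, hz, bit_not]
  rfl

/-! ## One more local repair -/

/-- **Repair through one AND slot with active partner**: toggling the variable at AND slot `s` while the other AND slot `t` carries
`true` toggles output `j`. -/
theorem eval_update_and_slot (I : LocalMap 4 n m) (hI : I.IsPure xorAndPred) (z : Fin n → Bool) (j : Fin m) (s t : Fin 4)
    (hs : 2 ≤ s.val) (ht : 2 ≤ t.val) (hst : s ≠ t) (hz : z (I.vars j t) = true) :
    I.eval (Function.update z (I.vars j s) (!z (I.vars j s))) j = !I.eval z j := by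
  have hinj := hI.2 j
  have hne : ∀ t' : Fin 4, t' ≠ s → I.vars j t' ≠ I.vars j s := fun t' ht' h => ht' (hinj h)
  rw [eval_pure I hI, eval_pure I hI]
  have hs23 : s = 2 ∨ s = 3 := by fin_cases s <;> simp at hs ⊢
  have ht23 : t = 2 ∨ t = 3 := by fin_cases t <;> simp at ht ⊢
  rcases hs23 with rfl | rfl
  · have ht3 : t = 3 := by rcases ht23 with rfl | rfl <;> simp_all
    subst ht3
    rw [Function.update_self, Function.update_of_ne (hne 0 (by decide)), Function.update_of_ne (hne 1 (by decide)),
      Function.update_of_ne (hne 3 (by decide)), hz]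
    cases z (I.vars j 0) <;> cases z (I.vars j 1) <;> cases z (I.vars j 2) <;> rfl
  · have ht2 : t = 2 := by rcases ht23 with rfl | rfl <;> simp_all
    subst ht2
    rw [Function.update_self, Function.update_of_ne (hne 0 (by decide)), Function.update_of_ne (hne 1 (by decide)),
      Function.update_of_ne (hne 2 (by decide)), hz]
    cases z (I.vars j 0) <;> cases z (I.vars j 1) <;> cases z (I.vars j 3) <;> rfl

/-! ## The repair lemma -/

section Repair

variable (I : LocalMap 4 n m) (hI : I.IsPure xorAndPred) (hT : Typed I) (y : Fin m → Bool) (J : Finset (Fin m))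
  (C : Finset (Fin n)) (c : Bool)

include hI hT

/-- **Repair with parity freedom.**  See the module docstring. -/
theorem repair (z₁ : Fin n → Bool) (R : Finset (Fin m)) (hRJ : R ⊆ J) (hRne : R.Nonempty)
    (hchord : ∀ g ∈ R, I.vars g 2 ∈ bdry I J ∧ I.vars g 3 ∈ bdry I J)
    (hCg : ∀ g ∈ R, I.vars g 2 ∈ C ∨ I.vars g 3 ∈ C)
    (hxor : ∀ g ∈ R, xor (z₁ (I.vars g 0)) (z₁ (I.vars g 1)) = y g)
    (hrest : ∀ j ∈ J, j ∉ R → I.eval z₁ j = y j) :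
    ∃ z : Fin n → Bool, parity C z = c ∧ ∀ j ∈ J, I.eval z j = y j := by
  classical
  -- the AND variables of `R`
  obtain ⟨P, hP⟩ : ∃ P : Finset (Fin n), ∀ v, v ∈ P ↔ ∃ g ∈ R, v = I.vars g 2 ∨ v = I.vars g 3 :=
    ⟨R.biUnion fun g => {I.vars g 2, I.vars g 3}, fun v => by simp⟩
  -- they are AND-type and private
  have hPand : ∀ v ∈ P, ∃ g ∈ R, ∃ s : Fin 4, 2 ≤ s.val ∧ I.vars g s = v := by
    intro v hv
    obtain ⟨g, hg, h⟩ := (hP v).1 hv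
    rcases h with rfl | rfl
    · exact ⟨g, hg, 2, by decide, rfl⟩
    · exact ⟨g, hg, 3, by decide, rfl⟩
  have hxP : ∀ (j : Fin m) (s : Fin 4), s.val < 2 → I.vars j s ∉ P := by
    intro j s hs hv
    obtain ⟨g, -, t, ht, hgt⟩ := hPand _ hv
    exact hT j g s t hs ht hgt.symm
  have hPpriv : ∀ v ∈ P, ∀ j ∈ J, v ∈ varSet I j → j ∈ R ∧ (v = I.vars j 2 ∨ v = I.vars j 3) := by
    intro v hv j hj hvj
    obtain ⟨g, hg, h⟩ := (hP v).1 hv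
    have hjg : j = g := by
      by_contra hne
      rcases h with rfl | rfl
      · exact not_mem_varSet_of_private I (hRJ hg) hj hne (hchord g hg).1 (vars_mem_varSet I g 2) hvj
      · exact not_mem_varSet_of_private I (hRJ hg) hj hne (hchord g hg).2 (vars_mem_varSet I g 3) hvj
    subst hjg
    exact ⟨hg, h⟩
  -- zero them
  obtain ⟨z₂, hz₂⟩ : ∃ z₂ : Fin n → Bool, ∀ v, z₂ v = if v ∈ P then false else z₁ v := ⟨_, fun _ => rfl⟩
  have hz₂R : ∀ g ∈ R, I.eval z₂ g = y g := by
    intro g hg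
    rw [eval_pure I hI, hz₂, hz₂, hz₂, if_neg (hxP g 0 (by decide)), if_neg (hxP g 1 (by decide)),
      if_pos ((hP _).2 ⟨g, hg, Or.inl rfl⟩), Bool.false_and, Bool.xor_false]
    exact hxor g hg
  have hz₂rest : ∀ j ∈ J, j ∉ R → I.eval z₂ j = y j := by
    intro j hj hjR
    rw [← hrest j hj hjR]
    refine eval_congr I j fun s => ?_
    rw [hz₂]
    split_ifs with h
    · exact absurd (hPpriv _ h j hj (vars_mem_varSet I j s)).1 hjR
    · rfl
  have hz₂J : ∀ j ∈ J, I.eval z₂ j = y j := fun j hj =>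
    if h : j ∈ R then hz₂R j h else hz₂rest j hj h
  -- fix the parity with one chord
  by_cases hpar : parity C z₂ = c
  · exact ⟨z₂, hpar, hz₂J⟩
  obtain ⟨g₀, hg₀⟩ := hRne
  obtain ⟨s₀, hs₀, hs₀C⟩ : ∃ s₀ : Fin 4, 2 ≤ s₀.val ∧ I.vars g₀ s₀ ∈ C := by
    rcases hCg g₀ hg₀ with h | h
    · exact ⟨2, by decide, h⟩
    · exact ⟨3, by decide, h⟩
  have hp₀P : I.vars g₀ s₀ ∈ P := by
    have : s₀ = 2 ∨ s₀ = 3 := by fin_cases s₀ <;> simp at hs₀ ⊢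
    rcases this with rfl | rfl
    · exact (hP _).2 ⟨g₀, hg₀, Or.inl rfl⟩
    · exact (hP _).2 ⟨g₀, hg₀, Or.inr rfl⟩
  have hz₂p₀ : z₂ (I.vars g₀ s₀) = false := by rw [hz₂, if_pos hp₀P]
  refine ⟨Function.update z₂ (I.vars g₀ s₀) true, ?_, fun j hj => ?_⟩
  · rw [parity_update_flip z₂ hs₀C hz₂p₀]
    revert hpar
    cases parity C z₂ <;> cases c <;> simp
  · by_cases hjg : j = g₀
    · subst hjg
      -- the AND product of `g₀` stays `false`: the other AND variable is still `false`
      have hinj := hI.2 j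
      have hne : ∀ t : Fin 4, t ≠ s₀ → I.vars j t ≠ I.vars j s₀ := fun t ht h => ht (hinj h)
      have h23 : (Function.update z₂ (I.vars j s₀) true (I.vars j 2) &&
          Function.update z₂ (I.vars j s₀) true (I.vars j 3)) = false := by
        have : s₀ = 2 ∨ s₀ = 3 := by fin_cases s₀ <;> simp at hs₀ ⊢
        rcases this with rfl | rfl
        · rw [Function.update_of_ne (hne 3 (by decide)), hz₂, if_pos ((hP _).2 ⟨j, hg₀, Or.inr rfl⟩), Bool.and_false]
        · rw [Function.update_of_ne (hne 2 (by decide)), hz₂, if_pos ((hP _).2 ⟨j, hg₀, Or.inl rfl⟩), Bool.false_and]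
      rw [eval_pure I hI, h23, Bool.xor_false, Function.update_of_ne (hne 0 (by fin_cases s₀ <;> simp at hs₀ ⊢)),
        Function.update_of_ne (hne 1 (by fin_cases s₀ <;> simp at hs₀ ⊢)), hz₂, hz₂,
        if_neg (hxP j 0 (by decide)), if_neg (hxP j 1 (by decide))]
      exact hxor j hg₀
    · rw [eval_update_of_not_mem I j z₂ ?_]
      · exact hz₂J j hj
      · intro hv
        exact hjg (by
          have := (hPpriv _ hp₀P j hj hv).1
          -- `vars g₀ s₀` is private to `g₀`
          by_contra hne
          have hb : I.vars g₀ s₀ ∈ bdry I J := by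
            have : s₀ = 2 ∨ s₀ = 3 := by fin_cases s₀ <;> simp at hs₀ ⊢
            rcases this with rfl | rfl
            · exact (hchord g₀ hg₀).1
            · exact (hchord g₀ hg₀).2
          exact not_mem_varSet_of_private I (hRJ hg₀) hj hne hb (vars_mem_varSet I g₀ s₀) hv)

/-- **Chords of an infeasible `J` sit at `(1,1)` in every solution** (S3). -/
theorem chord_true (hinf : ¬ ∃ z : Fin n → Bool, parity C z = c ∧ ∀ j ∈ J, I.eval z j = y j)
    {z : Fin n → Bool} (hz : ∀ j ∈ J, I.eval z j = y j) {g : Fin m} (hg : g ∈ J)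
    (hchord : I.vars g 2 ∈ bdry I J ∧ I.vars g 3 ∈ bdry I J) (hCg : I.vars g 2 ∈ C ∨ I.vars g 3 ∈ C) :
    z (I.vars g 2) = true ∧ z (I.vars g 3) = true := by
  by_contra hnot
  have hprod : (z (I.vars g 2) && z (I.vars g 3)) = false := by
    revert hnot
    cases z (I.vars g 2) <;> cases z (I.vars g 3) <;> simp
  apply hinf
  refine repair I hI hT y J C c z {g} (singleton_subset_iff.2 hg) (singleton_nonempty g) (fun g' hg' => ?_)
    (fun g' hg' => ?_) (fun g' hg' => ?_) (fun j hj hjg => hz j hj)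
  · rw [mem_singleton.1 hg']; exact hchord
  · rw [mem_singleton.1 hg']; exact hCg
  · rw [mem_singleton.1 hg']
    have e := hz g hg
    rw [eval_pure I hI, hprod, Bool.xor_false] at e
    exact e

end Repair

end Summit.PneNP.PneNP.Theorems.PstarGapOneAndRepair
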